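import Summits.ABC.StewartYu.KummerBasisChange
import Literature.NumberTheory.Transcendental.PhilipponZeroEstimate
import Mathlib.LinearAlgebra.Dimension.OrzechProperty
import Mathlib.LinearAlgebra.Dimension.Constructions
import HarnessLib

/-!
# Cell abc-stewartyu, Gen-3 frames: the obstruction lattice of the zero estimate is saturated, and a
# unimodular re-basing of it keeps independence and the `q`-Kummer condition

`Summits/ABC/StewartYu/KummerBasisChangeSaturated.lean` — cell `abc-stewartyu` (route `PadicPrimesKummerThird`,
cruxes `Y07Odd` stmt-ABC-19658 / `Y07Two` stmt-ABC-19659), seat p3 (g4), F-two lead; sequel of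
`KummerBasisChange.lean`.  Theorems only.

The zero estimate `Nesterenko2003_prop51` hands over a CONNECTED subgroup `H = 𝔙 × T_Φ`, i.e. a SATURATED
character lattice `Φ = H.chars` (`GaGm.ConnAlgSubgroup.saturated`), together with a `ℤ`-basis `M` of it
(`H.chars = AddSubgroup.closure (rows M)`, rows independent).  Hence:

* `qSaturated_span_of_chars` — `span_ℤ(rows M)` is `q`-saturated for every `q ≠ 0`, which is exactly the
  hypothesis `hsat` of `KummerBasisChange.kummer_basisChange`;
* `span_rows_combination_eq` / `linearIndependent_rows_combination` — replacing the basis `M` by `y·M`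
  for a family `y` of `r` integer vectors spanning `ℤʳ` (the output shape of Mahler's basis theorem
  `Dioph.exists_int_basis_le_of_directional`, used after the lattice lever) gives again a basis of `Φ`;
* `mulIndep_and_kummer_of_chars` — HEADLINE: the generators `θᵢ = ∏ⱼ αⱼ^{(y·M)ᵢⱼ}` of Matveev's step are
  multiplicatively independent and `q`-Kummer whenever the `αⱼ` are (any `q ≥ 1`; `q = 2` for F-odd,
  `q = 3` for F-two).

References: Yu. V. Nesterenko, LNM 1819 (2003), §5.1 ("`G*` is connected iff `Φ` is a direct factor of
`ℤⁿ`"), Prop. 2.6, Cor. 4.5; K. Yu, Acta Math. 211 (2013), §5 (the `q`-saturation).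
-/

open Finset
open Literature.NumberTheory.Transcendental
open Literature.NumberTheory.Transcendental.GaGm

namespace Summit.ABC.StewartYu.KummerBasisChange

variable {K : Type*} [Field K] {m r : ℕ}

/-- **The character lattice of a connected subgroup is saturated in `ℤᵐ`**: with `H.chars = closure(rows M)`,
`q • v ∈ span_ℤ(rows M) ⇒ v ∈ span_ℤ(rows M)` for every `q ≠ 0`.
[cite: Nesterenko2003, §5.1 ("`G*` is connected if and only if `Φ` is a direct factor of `ℤⁿ`")] -/
theorem qSaturated_span_of_chars (H : ConnAlgSubgroup m) (M : Fin r → Fin m → ℤ)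
    (hchars : H.chars = AddSubgroup.closure (Set.range M)) {q : ℤ} (hq : q ≠ 0)
    (v : Fin m → ℤ) (hv : q • v ∈ Submodule.span ℤ (Set.range M)) :
    v ∈ Submodule.span ℤ (Set.range M) := by
  have hcl : (Submodule.span ℤ (Set.range M)).toAddSubgroup = H.chars := by
    rw [hchars, Submodule.span_int_eq_addSubgroupClosure]
  have hv' : q • v ∈ H.chars := by
    rw [← hcl]; exact hv
  have hmem : v ∈ H.chars := H.saturated q v hq hv'
  rw [← hcl] at hmem
  exact hmem

/-- Re-basing by integer combinations: the rows `(y·M)ᵢ = ∑ₖ yᵢₖ Mₖ` lie in `span_ℤ(rows M)`, and span it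
as soon as the `yᵢ` span `ℤʳ`. [folklore] -/
theorem span_rows_combination_eq (M : Fin r → Fin m → ℤ) (y : Fin r → Fin r → ℤ)
    (hy : Submodule.span ℤ (Set.range y) = ⊤) :
    Submodule.span ℤ (Set.range fun i => ∑ k, y i k • M k) = Submodule.span ℤ (Set.range M) := by
  apply le_antisymm
  · refine Submodule.span_le.mpr ?_
    rintro _ ⟨i, rfl⟩
    exact Submodule.sum_mem _ fun k _ => Submodule.smul_mem _ _ (Submodule.subset_span ⟨k, rfl⟩)
  · refine Submodule.span_le.mpr ?_
    rintro _ ⟨k, rfl⟩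
    -- `e_k = ∑ᵢ cᵢ yᵢ` since the `yᵢ` span `ℤʳ`
    have hek : (Pi.single k (1 : ℤ) : Fin r → ℤ) ∈ Submodule.span ℤ (Set.range y) := by
      rw [hy]; exact Submodule.mem_top
    obtain ⟨c, hc⟩ := (Submodule.mem_span_range_iff_exists_fun ℤ).mp hek
    have hMk : M k = ∑ i, c i • (∑ k', y i k' • M k') := by
      have hcoord : ∀ k', ∑ i, c i * y i k' = if k' = k then 1 else 0 := by
        intro k'
        have := congrFun hc k'
        simpa [Finset.sum_apply, Pi.single_apply] using this
      calc M k = ∑ k', (if k' = k then (1 : ℤ) else 0) • M k' := by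
            simp only [ite_smul, one_smul, zero_smul, Finset.sum_ite_eq', Finset.mem_univ, if_true]
        _ = ∑ k', (∑ i, c i * y i k') • M k' := by
            refine Finset.sum_congr rfl fun k' _ => by rw [hcoord k']
        _ = ∑ i, c i • (∑ k', y i k' • M k') := by
            simp only [Finset.sum_smul, Finset.smul_sum, smul_smul]
            rw [Finset.sum_comm]
    rw [hMk]
    exact Submodule.sum_mem _ fun i _ => Submodule.smul_mem _ _ (Submodule.subset_span ⟨i, rfl⟩)

/-- `r` integer vectors spanning `ℤʳ` are linearly independent. [folklore] -/
theorem linearIndependent_of_span_eq_top (y : Fin r → Fin r → ℤ)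
    (hy : Submodule.span ℤ (Set.range y) = ⊤) : LinearIndependent ℤ y :=
  linearIndependent_of_top_le_span_of_card_eq_finrank hy.ge (by simp)

/-- Re-basing keeps linear independence of the rows. [folklore] -/
theorem linearIndependent_rows_combination (M : Fin r → Fin m → ℤ) (hM : LinearIndependent ℤ M)
    (y : Fin r → Fin r → ℤ) (hy : Submodule.span ℤ (Set.range y) = ⊤) :
    LinearIndependent ℤ (fun i => ∑ k, y i k • M k) := by
  have hyli := linearIndependent_of_span_eq_top y hy
  rw [Fintype.linearIndependent_iff]
  intro g hg i
  -- `∑ᵢ gᵢ (∑ₖ yᵢₖ Mₖ) = ∑ₖ (∑ᵢ gᵢ yᵢₖ) Mₖ = 0 ⇒ ∑ᵢ gᵢ yᵢₖ = 0 ⇒ g = 0`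
  have h1 : ∑ k, (∑ i, g i * y i k) • M k = 0 := by
    rw [← hg]
    simp only [Finset.sum_smul, Finset.smul_sum, smul_smul]
    rw [Finset.sum_comm]
  have h2 : ∀ k, ∑ i, g i * y i k = 0 := fun k =>
    Fintype.linearIndependent_iff.mp hM (fun k => ∑ i, g i * y i k) h1 k
  have h3 : ∑ i, g i • y i = 0 := by
    funext k
    simpa [Finset.sum_apply] using h2 k
  exact Fintype.linearIndependent_iff.mp hyli g h3 i

/-- **HEADLINE — Matveev's new generators keep independence and the `q`-Kummer condition.**  Data: the
obstruction subgroup `H` of the zero estimate with its basis `M` (`H.chars = closure(rows M)`, rows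
independent), a re-basing family `y` spanning `ℤʳ` (Mahler's basis after the lattice lever), nonzero
`αⱼ ∈ K` multiplicatively independent and `q`-Kummer (`q ≥ 1`), and `θᵢ = ∏ⱼ αⱼ^{∑ₖ yᵢₖ Mₖⱼ}`.  Then the
`θᵢ` are multiplicatively independent and `q`-Kummer. [cite: Nesterenko2003, Prop 2.6, Cor 4.5] -/
theorem mulIndep_and_kummer_of_chars (q : ℕ) (hq : 1 ≤ q) (α : Fin m → K) (hα : ∀ j, α j ≠ 0)
    (hind : ∀ φ : Fin m → ℤ, ∏ j, α j ^ φ j = 1 → φ = 0)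
    (hK : ∀ φ : Fin m → ℤ, (∃ γ : K, ∏ j, α j ^ φ j = γ ^ q) → ∀ j, (q : ℤ) ∣ φ j)
    (H : ConnAlgSubgroup m) (M : Fin r → Fin m → ℤ) (hM : LinearIndependent ℤ M)
    (hchars : H.chars = AddSubgroup.closure (Set.range M))
    (y : Fin r → Fin r → ℤ) (hy : Submodule.span ℤ (Set.range y) = ⊤)
    (θ : Fin r → K) (hθ : ∀ i, θ i = ∏ j, α j ^ (∑ k, y i k • M k) j) :
    (∀ μ : Fin r → ℤ, ∏ i, θ i ^ μ i = 1 → μ = 0) ∧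
      ∀ κ : Fin r → ℤ, (∃ γ : K, ∏ i, θ i ^ κ i = γ ^ q) → ∀ i, (q : ℤ) ∣ κ i := by
  have hZ := linearIndependent_rows_combination M hM y hy
  refine ⟨mulIndep_basisChange α hα hind _ hZ θ hθ, ?_⟩
  refine kummer_basisChange q α hα hK _ hZ (fun v hv => ?_) θ hθ
  rw [span_rows_combination_eq M y hy] at hv ⊢
  exact qSaturated_span_of_chars H M hchars (by exact_mod_cast (show q ≠ 0 by omega)) v hv

end Summit.ABC.StewartYu.KummerBasisChange
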